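import Literature.NumberTheory.EllipticCurves.CongruentNumberMonskySelmerParitySelmer
import Literature.NumberTheory.EllipticCurves.CongruentNumberCurveConductorSign
import Literature.NumberTheory.EllipticCurves.CongruentNumberCurveLSeriesProofs
import Literature.NumberTheory.EllipticCurves.RootNumberParityProofs
import Literature.NumberTheory.EllipticCurves.AnalyticRankOrderProofs
import HarnessLib

/-!
# Monsky's parity theorem for `s(D)` — part 6: the `2`-Selmer rank of `E_D` has the parity of the analytic rank

Heath-Brown, Invent. Math. **118** (1994), §1 p. 3 L13–L16 [HeathBrown1994SelmerCongruentII]: for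
square-free `D`, `s(D)` (`#Sel⁽²⁾(E_D/ℚ) = 2^{2+s(D)}`) is even iff `D ≡ 1, 2, 3 (mod 8)` — Monsky's
appendix, proved in parts 1–5 of this series.  Koblitz, GTM 97, Ch. II §5, Theorem (p. 84) (tree:
`congruentNumberCurve_completedL_functional_equation_odd / _even`, by complex multiplication): the
completed `L`-function of `E_D` satisfies `Λ(s) = w Λ(2 − s)` with `w = +1` for `D ≡ 1, 2, 3 (mod 8)`
and `w = −1` for `D ≡ 5, 6, 7 (mod 8)`, so `ord_{s=1} L(E_D, s)` is even iff `D ≡ 1, 2, 3 (mod 8)`.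
Together: **the `2`-Selmer rank of `E_D` and the analytic rank of `E_D` have the same parity, for
every square-free `D`, unconditionally** — the `2`-parity conjecture for the congruent number family,
by Monsky's elementary route (the appendix's "method can be applied to twists of other curves with
rational 2-torsion", p. 38 L14–L16; the general modular statement is Monsky, Math. Z. 221 (1996),
tree fact `monsky_selmerCorank_two_mod_two_eq`).

## What is here (all PROVED; no definitions, no named facts)

* §1 `neg_one_pow_analyticRank_eq_of_functional_equation` — for an elliptic `W / ℚ` with entire
  `L`-function, an entire `Λ` agreeing with `M^{s/2}(2π)^{-s}Γ(s)L(W, s)` on `Re s > 3/2` (ANY level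
  `M ≠ 0`) and satisfying `Λ(s) = ε Λ(2 − s)` has `ε = (−1)^{ord_{s=1} L(W,s)}`; hence
  `Even (ord) ↔ ε = 1` (`even_analyticRank_iff_of_functional_equation`).  (The level-`N_E` case is
  the tree's `HasFunctionalEquationSign.even_analyticRank_iff`; the archimedean factor does not
  vanish at `1` at any level.)
* §2 `even_analyticRank_congruentNumberCurve_iff` — **`ord_{s=1} L(E_n, s)` is even iff
  `n ≡ 1, 2, 3 (mod 8)`**, for every square-free `n`, unconditionally.
* §3 **`exists_card_selmerGroup_two_eq_pow_parity_analyticRank`** — for square-free `n`: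
  `#Sel⁽²⁾(E_n/ℚ) = 2^{2+s}` with `Even s ↔ Even (ord_{s=1} L(E_n, s))`; and, granting the
  Cassels–Tate pairing and `Ш(E_n)[2^∞]` finite (part 5), **`rk E_n(ℚ) ≡ ord_{s=1} L(E_n, s) (mod 2)`**
  (`even_mordellWeilRank_iff_even_analyticRank_of_casselsTate`) — the parity conjecture for `E_n`
  modulo those two hypotheses.

Cell `bsd-monsky` (prover-B).  AI provenance: written by an AI assistant; no human has reviewed it.

## References

* [HeathBrown1994SelmerCongruentII] D. R. Heath-Brown, Invent. Math. 118 (1994), §1 typescript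
  p. 3 L13–L24; Appendix (P. Monsky) p. 38 L5–L16.
* [KoblitzECMF1993] N. Koblitz, *Introduction to Elliptic Curves and Modular Forms*, GTM 97, Ch. II
  §5, Theorem (p. 84) (statement held through [TopYui2008Congruent] §3, p. 618).
* [SilvermanAEC2009] J. H. Silverman, *The Arithmetic of Elliptic Curves*, 2nd ed., App. C §16,
  Thm. C.16.3 and the remark following it (p. 451).
-/

noncomputable section

open scoped Classical

open Filter Topology Complex
open WeierstrassCurve
open Literature.NumberTheory.EllipticCurves.HeathBrown1994

namespace Literature.NumberTheory.EllipticCurves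

namespace MonskySelmerParity

/-! ## §1 The sign of a functional equation at any level is `(−1)^{ord}` -/

section AnyLevel

variable (W : WeierstrassCurve ℚ)

/-- **Order of vanishing at the centre, at any level**: for an elliptic `W / ℚ` with entire
`L`-function, an entire continuation `Λ` of `M^{s/2}(2π)^{-s}Γ(s)L(W, s)` (`M ≠ 0`) vanishes at
`s = 1` to order exactly `ord_{s=1} L(W, s)` (the archimedean factor is holomorphic and non-zero
at `1`).  The level-`N_E` case is the tree's `analyticOrderAt_completedLContinuation_one`; the same
level-generic statement is proved in the sub-lane file
`Summits/…/P2/CongruentNumberPairsAtTwoSelmerGenusBridge` (a Summits module, not importable here —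
hence this Literature copy). [cite: SilvermanAEC2009, App. C §16, Thm. C.16.3 and the sentence following it] -/
theorem analyticOrderAt_completedLContinuation_one_of_level [W.IsElliptic]
    (hE : W.HasEntireLFunction) {M : ℕ} (hM : M ≠ 0) {Λ : ℂ → ℂ}
    (hΛ : Λ ∈ W.completedLContinuations M) : analyticOrderAt Λ 1 = W.analyticRank := by
  have hUo : IsOpen {s : ℂ | 0 < s.re} := isOpen_lt continuous_const Complex.continuous_re
  have h1 : (1 : ℂ) ∈ {s : ℂ | 0 < s.re} := by simp
  set h : ℂ → ℂ := fun s ↦ (M : ℂ) ^ (s / 2) * (2 * Real.pi : ℂ) ^ (-s) * Complex.Gamma s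
    with hdef
  have hev : Λ =ᶠ[𝓝 1] fun s ↦ h s * W.entireLFunction s := by
    filter_upwards [hUo.mem_nhds h1] with s hs
    exact W.completedLContinuation_eqOn_of_re_pos hE hM hΛ hs
  rw [analyticOrderAt_congr hev, W.analyticRank_eq_analyticOrderAt hE]
  have hh : AnalyticAt ℂ h 1 :=
    (DifferentiableOn.analyticAt (s := {s : ℂ | 0 < s.re})
      (fun s hs ↦ (differentiableAt_archFactor hM hs).differentiableWithinAt)
      (hUo.mem_nhds h1))
  have hL : AnalyticAt ℂ W.entireLFunction 1 := (W.differentiable_entireLFunction hE).analyticAt 1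
  have hh0 : analyticOrderAt h 1 = 0 :=
    hh.analyticOrderAt_eq_zero.mpr (archFactor_ne_zero hM (by simp))
  have := analyticOrderAt_mul hh hL
  rw [hh0, zero_add] at this
  exact this

/-- **The sign of a functional equation, at any level, is `(−1)^{ord_{s=1} L(W,s)}`**: if `W / ℚ`
is elliptic with entire `L`-function and an entire `Λ` agrees with `M^{s/2}(2π)^{-s}Γ(s)L(W, s)` on
`Re s > 3/2` (`M ≠ 0`) and satisfies `Λ(s) = ε Λ(2 − s)`, then `ε = (−1)^{ord}`: `G(t) = Λ(1+t)`
has `G(−t) = ε G(t)` and vanishes to order `ord` at `0`. [cite: SilvermanAEC2009, App. C §16, Thm. C.16.3 and remark (p. 451)] -/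
theorem neg_one_pow_analyticRank_eq_of_functional_equation [W.IsElliptic]
    (hE : W.HasEntireLFunction) {M : ℕ} (hM : M ≠ 0) {Λ : ℂ → ℂ} (hd : Differentiable ℂ Λ)
    (hv : ∀ s : ℂ, 3 / 2 < s.re →
      Λ s = (M : ℂ) ^ (s / 2) * (2 * Real.pi : ℂ) ^ (-s) * Complex.Gamma s * W.LSeries s)
    {ε : ℂ} (hfe : ∀ s : ℂ, Λ s = ε * Λ (2 - s)) : (-1 : ℂ) ^ W.analyticRank = ε := by
  have hΛ := mem_completedLContinuations_of_eq_LSeries W hd hv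
  set G : ℂ → ℂ := fun t ↦ Λ (1 + t) with hGdef
  have hGan : AnalyticAt ℂ G 0 := by
    have hΛ1 : AnalyticAt ℂ Λ (1 + 0) := hd.analyticAt _
    exact hΛ1.comp_of_eq (analyticAt_const.add analyticAt_id) rfl
  have hGord : analyticOrderAt G 0 = W.analyticRank := by
    have hg : AnalyticAt ℂ (fun t : ℂ ↦ 1 + t) 0 := analyticAt_const.add analyticAt_id
    have hg' : deriv (fun t : ℂ ↦ 1 + t) 0 ≠ 0 := by
      rw [deriv_const_add, deriv_id'']
      exact one_ne_zero
    have := analyticOrderAt_comp_of_deriv_ne_zero (f := Λ) hg hg'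
    simp only [Function.comp_def, add_zero] at this
    rw [hGdef, this]
    exact analyticOrderAt_completedLContinuation_one_of_level W hE hM hΛ
  have hGfe : ∀ t : ℂ, G (-t) = ε * G t := by
    intro t
    show Λ (1 + -t) = ε * Λ (1 + t)
    rw [hfe (1 + -t)]
    congr 2
    ring
  exact neg_one_pow_eq_of_comp_neg_eq_mul hGan hGord hGfe

/-- **Parity from the sign, at any level**: under the hypotheses of
`neg_one_pow_analyticRank_eq_of_functional_equation`, `ord_{s=1} L(W, s)` is even iff `ε = 1`.
[cite: SilvermanAEC2009, App. C §16, Thm. C.16.3 and remark (p. 451)] -/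
theorem even_analyticRank_iff_of_functional_equation [W.IsElliptic]
    (hE : W.HasEntireLFunction) {M : ℕ} (hM : M ≠ 0) {Λ : ℂ → ℂ} (hd : Differentiable ℂ Λ)
    (hv : ∀ s : ℂ, 3 / 2 < s.re →
      Λ s = (M : ℂ) ^ (s / 2) * (2 * Real.pi : ℂ) ^ (-s) * Complex.Gamma s * W.LSeries s)
    {ε : ℂ} (hfe : ∀ s : ℂ, Λ s = ε * Λ (2 - s)) : Even W.analyticRank ↔ ε = 1 := by
  have h := neg_one_pow_analyticRank_eq_of_functional_equation W hE hM hd hv hfe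
  constructor
  · intro he
    rw [← h, he.neg_one_pow]
  · intro h1
    by_contra hodd
    rw [Nat.not_even_iff_odd] at hodd
    rw [hodd.neg_one_pow, h1] at h
    norm_num at h

end AnyLevel

/-! ## §2 The analytic rank of `E_n` is even iff `n ≡ 1, 2, 3 (mod 8)` -/

/-- `χ₋₄(n)χ₈(n) ∈ ℂ` is `1` iff `n ≡ 1, 3 (mod 8)`, for odd `n`.
[cite: KoblitzECMF1993, Ch. II §5, Theorem (p. 84)] -/
theorem χ₄_mul_χ₈_eq_one_iff {n : ℕ} (hodd : Odd n) :
    ((ZMod.χ₄ n : ℤ) : ℂ) * ((ZMod.χ₈ n : ℤ) : ℂ) = 1 ↔ n % 8 = 1 ∨ n % 8 = 3 := by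
  have h2 : n % 2 = 1 := Nat.odd_iff.mp hodd
  refine ⟨fun h => ?_, χ₄_mul_χ₈_eq_one⟩
  by_contra h8
  have h8' : n % 8 = 5 ∨ n % 8 = 7 := by omega
  rw [χ₄_mul_χ₈_eq_neg_one h8'] at h
  norm_num at h

/-- `χ₋₄(d) ∈ ℂ` is `1` iff `d ≡ 1 (mod 4)`, for odd `d`. [cite: KoblitzECMF1993, Ch. II §5, Theorem (p. 84)] -/
theorem χ₄_eq_one_iff {d : ℕ} (hodd : Odd d) : ((ZMod.χ₄ d : ℤ) : ℂ) = 1 ↔ d % 4 = 1 := by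
  have h2 : d % 2 = 1 := Nat.odd_iff.mp hodd
  rw [ZMod.χ₄_nat_eq_if_mod_four, if_neg (by omega)]
  by_cases h4 : d % 4 = 1
  · rw [if_pos h4]; simp [h4]
  · rw [if_neg h4]; norm_num; exact h4

/-- **`ord_{s=1} L(E_n, s)` is even iff `n ≡ 1, 2, 3 (mod 8)`**, for every square-free `n`,
unconditionally: Koblitz's CM functional equation `Λ(s) = w Λ(2 − s)` (`w = χ₋₄(n)χ₈(n)` at level
`32n²` for odd `n`, `w = χ₋₄(n/2)` at level `16n²` for even `n`; tree:
`congruentNumberCurve_completedL_functional_equation_odd / _even`) and §1.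
[cite: KoblitzECMF1993, Ch. II §5, Theorem (p. 84)] [cite: TopYui2008Congruent, §3, p. 618] -/
theorem even_analyticRank_congruentNumberCurve_iff {n : ℕ} (hsq : Squarefree n) :
    haveI := isElliptic_congruentNumberCurve hsq.ne_zero
    Even (congruentNumberCurve n).analyticRank ↔ n % 8 = 1 ∨ n % 8 = 2 ∨ n % 8 = 3 := by
  haveI : NeZero n := ⟨hsq.ne_zero⟩
  haveI := isElliptic_congruentNumberCurve hsq.ne_zero
  have hE := hasEntireLFunction_congruentNumberCurve_holds hsq
  rcases Nat.even_or_odd n with heven | hodd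
  · obtain ⟨d, rfl⟩ := heven.two_dvd
    haveI : NeZero d := ⟨fun h ↦ by simp [h] at hsq⟩
    have hdodd : Odd d := odd_of_squarefree_two_mul hsq
    have hd2 : d % 2 = 1 := Nat.odd_iff.mp hdodd
    obtain ⟨Λ, hdiff, hv, hfe⟩ := congruentNumberCurve_completedL_functional_equation_even hsq
    rw [even_analyticRank_iff_of_functional_equation _ hE (M := 64 * d ^ 2)
      (mul_ne_zero (by norm_num) (pow_ne_zero 2 (NeZero.ne d))) hdiff hv hfe, χ₄_eq_one_iff hdodd]
    omega
  · have h2 : n % 2 = 1 := Nat.odd_iff.mp hodd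
    obtain ⟨Λ, hd, hv, hfe⟩ := congruentNumberCurve_completedL_functional_equation_odd hsq hodd
    rw [even_analyticRank_iff_of_functional_equation _ hE (M := 32 * n ^ 2)
      (mul_ne_zero (by norm_num) (pow_ne_zero 2 hsq.ne_zero)) hd hv hfe, χ₄_mul_χ₈_eq_one_iff hodd]
    omega

/-! ## §3 `2`-Selmer parity = analytic parity for `E_n`; the parity of the rank granting Cassels–Tate -/

/-- **The `2`-Selmer rank of `E_n` has the parity of the analytic rank, for every square-free `n`,
unconditionally**: there is `s` (Monsky's `s(n)`) with `#Sel⁽²⁾(E_n/ℚ) = 2^{2+s}`, `rk E_n(ℚ) ≤ s`,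
and `s ≡ ord_{s=1} L(E_n, s) (mod 2)` — both sides are even exactly for `n ≡ 1, 2, 3 (mod 8)`
(Monsky's parity theorem; Koblitz's sign). [cite: HeathBrown1994SelmerCongruentII, §1 typescript p. 3 L13–L16; Appendix (Monsky) p. 38 L5–L16]
[cite: KoblitzECMF1993, Ch. II §5, Theorem (p. 84)] -/
theorem exists_card_selmerGroup_two_eq_pow_parity_analyticRank {n : ℕ} (hsq : Squarefree n) :
    ∃ s : ℕ, Nat.card ((congruentNumberCurve n).selmerGroup 2) = 2 ^ (2 + s) ∧
      (haveI := isElliptic_congruentNumberCurve hsq.ne_zero; (congruentNumberCurve n).mordellWeilRank ≤ s) ∧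
      (haveI := isElliptic_congruentNumberCurve hsq.ne_zero;
        (Even s ↔ Even (congruentNumberCurve n).analyticRank)) := by
  obtain ⟨s, h1, h2, h3⟩ := exists_card_selmerGroup_two_eq_pow hsq
  exact ⟨s, h1, h2, by rw [h3, even_analyticRank_congruentNumberCurve_iff hsq]⟩

/-- **Granting the Cassels–Tate pairing and `Ш(E_n)[2^∞]` finite, `rk E_n(ℚ) ≡ ord_{s=1} L(E_n, s) (mod 2)`**
for every square-free `n` (the parity conjecture for the congruent number family, modulo these two
explicit hypotheses). [cite: HeathBrown1994SelmerCongruentII, §1 typescript p. 3 L13–L24]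
[cite: KoblitzECMF1993, Ch. II §5, Theorem (p. 84)] -/
theorem even_mordellWeilRank_iff_even_analyticRank_of_casselsTate {n : ℕ} (hsq : Squarefree n)
    (hCT : exists_casselsTate_pairing (K := ℚ))
    (hfin : haveI := isElliptic_congruentNumberCurve hsq.ne_zero;
      Finite (AddCommGroup.primaryComponent (congruentNumberCurve n).sha 2)) :
    haveI := isElliptic_congruentNumberCurve hsq.ne_zero
    Even (congruentNumberCurve n).mordellWeilRank ↔ Even (congruentNumberCurve n).analyticRank := by
  rw [even_mordellWeilRank_iff_of_casselsTate hsq hCT hfin, even_analyticRank_congruentNumberCurve_iff hsq]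

end MonskySelmerParity

end Literature.NumberTheory.EllipticCurves

end
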